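import Literature.Topology.FourManifolds.SurfaceGroupCayleyFan
import HarnessLib

/-!
# The Cayley complex of the surface group: simple circuits

Topic `Literature/Topology/FourManifolds`.  Fourth file of pillar **(B)** (planar counting,
Zieschang–Vogt–Coldewey Thm. 5.4.2 / Cor. 5.4.3) of the algebraic proof of Nielsen's theorem
(`SurfaceGroupCayleyPaths.lean`, `…Faces.lean`, `…Fan.lean`).

A simple circuit `w` (`IsSimpleCircuit`, `SurfaceGroupNielsenSetup.lean`) read from the vertex
`1`, with vertices `vtx 1 w k`, letters `w[k]`, traversed edges `e_k = edgeOf (vtx 1 w k) w[k]`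
and traversal chain `T = trav 1 w`:

* its vertices are pairwise distinct and consecutive letters do not cancel, also cyclically
  (`IsSimpleCircuit.vtx_injective`, `…getElem_succ_ne_linv`, `…getElem_zero_ne_linv`);
* its edges are pairwise distinct (`IsSimpleCircuit.edge_injective`), so `T e_k = ±1`
  (`…trav_apply_edge`) and, for a `2`-chain `n` with boundary `T`, the same-direction face
  `S_k = sface (vtx 1 w k) w[k]` and the opposite face `O_k` of the `k`-th traversal satisfy
  `n S_k - n O_k = 1` (`…apply_sface_sub_apply_oface`);
* the only out-edges at the vertex `vtx 1 w (k+1)` in the support of `T` are those of `w[k]⁻¹`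
  and `w[k+1]`, hence by the fan lemma `S_k` and `S_{k+1}` are `T`-connected
  (`…faceConn_sface_succ`), and every face is `T`-connected to some `S_k` or `O_k`
  (`…exists_faceConn`);
* **reading off the relator** (`…eq_rotate_of_sface_eq`): if all `S_k` are one face `F₀`, then
  `w` is a rotation of the relator word (the boundary of `F₀`).

## References

* H. Zieschang, E. Vogt, H.-D. Coldewey, *Surfaces and Planar Discontinuous Groups*, LNM 835,
  Springer (1980), §5.4 (Thm. 5.4.2, Cor. 5.4.3). [ZieschangVogtColdewey1980]
-/

noncomputable section

namespace Literature.Topology.FourManifolds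

open Literature.GroupTheory.CombinatorialGroupTheory List

namespace SurfaceGroup

variable {g : ℕ} {w : List (surfaceGen g × Bool)}

/-! ## Vertices and letters of a simple circuit -/

/-- A simple circuit has positive length. [folklore] -/
theorem IsSimpleCircuit.length_pos (hw : IsSimpleCircuit w) : 0 < w.length := length_pos_iff.2 hw.1

/-- A simple circuit lives in genus `≥ 1` (it has a letter). [folklore] -/
theorem IsSimpleCircuit.one_le (hw : IsSimpleCircuit w) : 1 ≤ g := (w.head hw.1).1.1.pos

/-- A simple circuit is closed: its last vertex is its first. [folklore] -/
theorem IsSimpleCircuit.vtx_len (hw : IsSimpleCircuit w) : vtx 1 w w.length = 1 := by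
  rw [vtx_length, hw.2.2.1, mul_one]

/-- **The vertices of a simple circuit are pairwise distinct.** [folklore] -/
theorem IsSimpleCircuit.vtx_injective (hw : IsSimpleCircuit w) {k l : ℕ} (hk : k < w.length) (hl : l < w.length)
    (h : vtx 1 w k = vtx 1 w l) : k = l := by
  by_contra hne
  rcases lt_or_gt_of_ne hne with hkl | hkl
  · exact hw.2.2.2 k l hkl hl (by simpa [vtx] using h)
  · exact hw.2.2.2 l k hkl hk (by simpa [vtx] using h.symm)

/-- Changing the index of a letter along an equality of indices. [folklore] -/
theorem getElem_idx_congr {k l : ℕ} (h : k = l) (hk : k < w.length) (hl : l < w.length) : w[k] = w[l] := by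
  subst h; rfl

/-- **Consecutive letters of a simple circuit do not cancel.** [folklore] -/
theorem IsSimpleCircuit.getElem_succ_ne_linv (hw : IsSimpleCircuit w) {k : ℕ} (hk : k + 1 < w.length) :
    w[k + 1] ≠ linv w[k] := by
  intro h
  have hc := (List.isChain_iff_getElem.1 hw.2.1) k hk
  rw [h, linv_fst, linv_snd] at hc
  simpa using hc rfl

/-- **A simple circuit is cyclically reduced**: its first and last letters do not cancel. [folklore] -/
theorem IsSimpleCircuit.getElem_zero_ne_linv (hw : IsSimpleCircuit w) :
    w[0]'hw.length_pos ≠ linv (w[w.length - 1]'(by have := hw.length_pos; omega)) := by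
  intro h
  have hm := hw.length_pos
  by_cases h1 : w.length = 1
  · have : w[0]'hw.length_pos = w[w.length - 1]'(by omega) := getElem_idx_congr (by omega) _ _
    rw [← this] at h
    exact linv_ne_self _ h.symm
  · -- the second vertex equals the last-but-one vertex
    have hv1 : vtx 1 w 1 = lval (w[0]'hw.length_pos) := by
      rw [vtx_succ 1 w hm, vtx_zero, one_mul]
    have hvl : vtx 1 w (w.length - 1) = (lval (w[w.length - 1]'(by omega)))⁻¹ := by
      have := vtx_succ 1 w (k := w.length - 1) (by omega)
      rw [Nat.sub_add_cancel hm, hw.vtx_len] at this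
      exact eq_inv_of_mul_eq_one_left this.symm
    rw [← lval_linv, ← h, ← hv1] at hvl
    have h2 : w.length = 2 := by have := hw.vtx_injective (by omega) (by omega) hvl; omega
    refine hw.getElem_succ_ne_linv (k := 0) (by omega) ?_
    rw [h, linv_linv]
    exact getElem_idx_congr (by omega) _ _

/-! ## The traversed edges of a simple circuit -/

/-- **The edges traversed by a simple circuit are pairwise distinct.**
[cite: ZieschangVogtColdewey1980, §5.4] -/
theorem IsSimpleCircuit.edge_injective (hw : IsSimpleCircuit w) {k l : ℕ} (hk : k < w.length) (hl : l < w.length)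
    (h : edgeOf (vtx 1 w k) w[k] = edgeOf (vtx 1 w l) w[l]) : k = l := by
  rcases (edgeOf_eq_edgeOf_iff _ _ _ _).1 h with ⟨hv, -⟩ | ⟨hv, hℓ⟩
  · exact hw.vtx_injective hk hl hv
  · exfalso
    rw [← vtx_succ 1 w hl] at hv
    rcases Nat.lt_or_ge (l + 1) w.length with hl1 | hl1
    · have := hw.vtx_injective hk hl1 hv
      subst this
      exact hw.getElem_succ_ne_linv hl1 hℓ
    · have hlm : l + 1 = w.length := le_antisymm hl hl1
      have h0 : vtx 1 w k = vtx 1 w 0 := by rw [hv, hlm, hw.vtx_len, vtx_zero]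
      have hk0 := hw.vtx_injective hk hw.length_pos h0
      subst hk0
      refine hw.getElem_zero_ne_linv ?_
      rw [hℓ]
      congr 1
      exact getElem_idx_congr (by omega) _ _

/-- **The traversal chain of a simple circuit is `±1` on each of its edges** (the sign of the
letter). [cite: ZieschangVogtColdewey1980, §5.4] -/
theorem IsSimpleCircuit.trav_apply_edge (hw : IsSimpleCircuit w) {k : ℕ} (hk : k < w.length) :
    trav 1 w (edgeOf (vtx 1 w k) w[k]) = bsign (w[k]).2 :=
  trav_apply_edge_of_injective 1 w (fun _ _ hk hl h => hw.edge_injective hk hl h) hk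

/-- **At an inner vertex of a simple circuit only the incoming and the outgoing edge are in the
support of its traversal chain.** [folklore] -/
theorem IsSimpleCircuit.trav_apply_edgeOf_eq_zero (hw : IsSimpleCircuit w) {k : ℕ} (hk : k + 1 < w.length)
    (μ : surfaceGen g × Bool) (h1 : μ ≠ linv w[k]) (h2 : μ ≠ w[k + 1]) :
    trav 1 w (edgeOf (vtx 1 w (k + 1)) μ) = 0 := by
  by_contra hne
  obtain ⟨j, hj, he⟩ := exists_edgeOf_eq_of_trav_apply_ne_zero 1 w _ hne
  rcases (edgeOf_eq_edgeOf_iff _ _ _ _).1 he.symm with ⟨hv, hμ⟩ | ⟨hv, hμ⟩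
  · have := hw.vtx_injective hk hj hv
    subst this
    exact h2 hμ
  · rw [← vtx_succ 1 w hj] at hv
    rcases Nat.lt_or_ge (j + 1) w.length with hj1 | hj1
    · have := hw.vtx_injective hk hj1 hv
      have hkj : k = j := by omega
      subst hkj
      exact h1 hμ
    · have hjm : j + 1 = w.length := by omega
      have h0 : vtx 1 w (k + 1) = vtx 1 w 0 := by rw [hv, hjm, hw.vtx_len, vtx_zero]
      exact absurd (hw.vtx_injective hk hw.length_pos h0) (Nat.succ_ne_zero k)

/-- **Consecutive same-direction faces of a simple circuit are connected avoiding the circuit**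
(the fan lemma at the vertex between the two traversals). [cite: ZieschangVogtColdewey1980, proof of Thm. 5.4.2] -/
theorem IsSimpleCircuit.faceConn_sface_succ (hw : IsSimpleCircuit w) {k : ℕ} (hk : k + 1 < w.length) :
    FaceConn (trav 1 w) (sface (vtx 1 w k) w[k]) (sface (vtx 1 w (k + 1)) w[k + 1]) := by
  rw [sface_eq_oface_linv, ← vtx_succ 1 w (by omega)]
  exact faceConn_oface_sface _ _ (fun h => hw.getElem_succ_ne_linv hk h.symm) fun μ h1 h2 =>
    hw.trav_apply_edgeOf_eq_zero hk μ h1 h2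

/-- **Across an edge of the circuit a bounding `2`-chain drops by one**: for a `2`-chain `n` with
boundary the traversal chain, `n (same-direction face) - n (opposite face) = 1` at every
traversal. [cite: ZieschangVogtColdewey1980, proof of Thm. 5.4.2] -/
theorem IsSimpleCircuit.apply_sface_sub_apply_oface (hw : IsSimpleCircuit w) {n : SurfaceGroup g →₀ ℤ}
    (hT : ∀ e, trav 1 w e = n (Fplus e) - n (Fminus e)) {k : ℕ} (hk : k < w.length) :
    n (sface (vtx 1 w k) w[k]) - n (oface (vtx 1 w k) w[k]) = 1 := by
  have h := hw.trav_apply_edge hk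
  rw [hT] at h
  rcases Fplus_Fminus_edgeOf (vtx 1 w k) w[k] with ⟨hs, h1, h2⟩ | ⟨hs, h1, h2⟩
  · rw [h1, h2, hs] at h
    simpa [bsign] using h
  · rw [h1, h2, hs] at h
    simp [bsign] at h
    linarith

/-- **Every face is connected, avoiding the circuit, to a face at the circuit.** [folklore] -/
theorem IsSimpleCircuit.exists_faceConn (hw : IsSimpleCircuit w) (F : SurfaceGroup g) :
    ∃ k, ∃ hk : k < w.length, FaceConn (trav 1 w) F (sface (vtx 1 w k) w[k]) ∨
      FaceConn (trav 1 w) F (oface (vtx 1 w k) w[k]) := by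
  have h0 := hw.length_pos
  rcases faceConn_or_exists_of_faceConn_zero (trav 1 w) (faceConn_zero hw.one_le F (sface (vtx 1 w 0) w[0]))
    with h | ⟨e, he, h⟩
  · exact ⟨0, h0, Or.inl h⟩
  · obtain ⟨k, hk, rfl⟩ := exists_edgeOf_eq_of_trav_apply_ne_zero 1 w e he
    refine ⟨k, hk, ?_⟩
    rcases h with h | h
    · rcases (faces_edgeOf_iff (vtx 1 w k) w[k] _).1 (Or.inl rfl) with h' | h'
      · rw [h'] at h; exact Or.inl h
      · rw [h'] at h; exact Or.inr h
    · rcases (faces_edgeOf_iff (vtx 1 w k) w[k] _).1 (Or.inr rfl) with h' | h'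
      · rw [h'] at h; exact Or.inl h
      · rw [h'] at h; exact Or.inr h

/-! ## Reading off the relator -/

/-- **Reading off the relator**: if every traversal of the simple circuit `w` has the same
same-direction face `F₀`, then `w` is a rotation of the relator word — it is the boundary of `F₀`
read from the vertex `1`. [cite: ZieschangVogtColdewey1980, Cor. 5.4.3] -/
theorem IsSimpleCircuit.eq_rotate_of_sface_eq (hw : IsSimpleCircuit w) {F₀ : SurfaceGroup g}
    (hF : ∀ k (hk : k < w.length), sface (vtx 1 w k) w[k] = F₀) :
    ∃ k₀, w = (surfaceWordStd g).rotate k₀ := by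
  have hm := hw.length_pos
  have hg := hw.one_le
  -- the vertices of `w` on the boundary of `F₀`
  have hv : ∀ k (hk : k < w.length), vtx 1 w k = F₀ * rvtx g (pos w[k]) := fun k hk =>
    ((eq_sface_iff _ _ _).1 (hF k hk).symm).symm
  have hv' : ∀ k (hk : k < w.length), vtx 1 w (k + 1) = F₀ * rvtx g (pos w[k] + 1) := fun k hk => by
    rw [vtx_succ 1 w hk, hv k hk, rvtx_pos_succ, mul_assoc]
  -- consecutive letters sit at consecutive positions of the relator
  have hstep : ∀ k (hk : k + 1 < w.length), pos w[k + 1] = (pos w[k] + 1) % (4 * g) := by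
    intro k hk
    have h := hv (k + 1) hk
    rw [hv' k (by omega)] at h
    have h' := mul_left_cancel h
    rcases eq_or_eq_of_rvtx_eq (pos_lt _) (show pos w[k] + 1 ≤ 4 * g from pos_lt _) h'.symm with h1 | ⟨h1, h2⟩
    · rw [h1, Nat.mod_eq_of_lt (by rw [← h1]; exact pos_lt _)]
    · rw [h1, h2, Nat.mod_self]
  have hpos : ∀ k (hk : k < w.length), pos w[k] = (pos w[0] + k) % (4 * g) := by
    intro k hk
    induction k with
    | zero => rw [add_zero, Nat.mod_eq_of_lt (pos_lt _)]
    | succ k ih => rw [hstep k hk, ih (by omega), Nat.mod_add_mod, add_assoc]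
  -- the length is `4g`
  have hle : w.length ≤ 4 * g := by
    by_contra! hlt
    have h1 : vtx 1 w (4 * g) = vtx 1 w 0 := by
      rw [hv _ hlt, hv 0 hm, hpos _ hlt, Nat.add_mod_right, Nat.mod_eq_of_lt (pos_lt _)]
    have := hw.vtx_injective hlt hm h1
    omega
  have hdvd : 4 * g ∣ w.length := by
    have h1 : vtx 1 w (w.length - 1 + 1) = vtx 1 w 0 := by rw [Nat.sub_add_cancel hm, hw.vtx_len, vtx_zero]
    rw [hv' _ (by omega), hv 0 hm] at h1
    have h2 := mul_left_cancel h1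
    have h3 := hpos (w.length - 1) (by omega)
    obtain ⟨q, hq⟩ : ∃ q, pos w[0] + (w.length - 1) = 4 * g * q + pos w[w.length - 1] :=
      ⟨(pos w[0] + (w.length - 1)) / (4 * g), by rw [h3]; exact (Nat.div_add_mod _ _).symm⟩
    have hp0 := pos_lt w[0]
    rcases eq_or_eq_of_rvtx_eq (pos_lt _) (show pos w[w.length - 1] + 1 ≤ 4 * g from pos_lt _) h2.symm
      with h4 | ⟨h4, h5⟩
    · exact ⟨q, by omega⟩
    · exact ⟨q + 1, by rw [mul_add_one]; omega⟩
  have hlen : w.length = 4 * g := le_antisymm hle (Nat.le_of_dvd hm hdvd)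
  -- conclude letter by letter
  refine ⟨pos w[0], List.ext_getElem (by rw [length_rotate, length_surfaceWordStd, hlen]) fun k hk hk' => ?_⟩
  rw [getElem_rotate]
  conv_lhs => rw [← getElem_pos w[k] (h := by rw [length_surfaceWordStd]; exact pos_lt _)]
  congr 1
  rw [hpos k hk, length_surfaceWordStd, add_comm]

end SurfaceGroup

end Literature.Topology.FourManifolds
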